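import Summits.Ventures.PercRepro.C041TriDomSharingS1

/-!
# ROW C-041 — THE ANCHORED DELETION–CONTRACTION CONE: every pattern functional that is anchored at a mark is a theorem
on every up-set of every status (p6, gen 48; P6-TWOEXIT-LEAN.md §53 ADDENDUM 22 cont. 2)

THEOREM (THE ANCHORED CONE) (`cntF_nonneg_of_anchored`).  Let `F : P3 → P3 → ℤ` be a functional on pairs (red
pattern, blue pattern) of the marks `x = a₁`, `y = u`, `z = u'` such that
 (a) `F s t = 0` whenever the anchor's two connections agree in `s` and `t` (`Anchored`),
 (i) `F s t ≤ F s' t` for every x-merge `s → s'` (`IncrRed`),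
 (ii) `F s t + F s' t' ≤ F s' t + F s t'` for x-merges `s → s'`, `t → t'` (`KeyIneq`),
all on transitive patterns.  Then `0 ≤ Σ_{ω ∈ V} F (rsig st ω) (bsig st ω)` for every status `st` and every up-set
`V`.  PROOF: the proof of THEOREM (S1) (`cntS1_nonneg`) with `S1F` abstracted — induction on the number of free edges,
the free edge chosen touching the double-component of the anchor; case (A) by (a), the step by (i)–(ii) at the x-merges
`xmerge_rsig` / `xmerge_bsig`.  The set of such `F` is a polyhedral cone (the x-ANCHORED CONE); S1 is a member
(`S1F`), and so is every generalized two-mark domination of the anchor.  INSTANCES here: the set domination of the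
anchor against the two exits on the up-set «the exits are blue-separated» (`setDomF`, `cntF_setDom_nonneg`: «`x`
blue-connected to exactly one of `y, z` and red-connected to neither» is outnumbered by «`x` red-connected to `y` or
`z` and blue-isolated»), which is the anchored orientation's one-mark-edge statement for the edge `yz` read at the
anchor, and the (x,z)-two-mark domination as a functional (`twoMarkF`).  A functional's membership is decided by
`decide` (`Anchored`, `IncrRed`, `KeyIneq` are decidable); the conjecture's own functional is NOT a member (the
x-merge `⊥ → s₂` with `τ = s₃` creates `(s₂,s₃)` from a neutral colouring) — see ADDENDUM 22 cont. 2.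
-/

namespace PercRepro

namespace ZoneZ

namespace MultiExit

open ZoneData Finset

variable {V₁ E₁ U₁ U₂ : Type} (Z₁ : ZoneData V₁ E₁ U₁ U₂) (u u' a₁ : V₁)

variable [DecidableEq E₁]

/-! ## The three conditions -/

/-- (a) The functional vanishes when the anchor's connections agree in the two colours. -/
def Anchored (F : P3 → P3 → ℤ) : Prop := ∀ s t : P3, s.1 = t.1 → s.2.1 = t.2.1 → F s t = 0

/-- (i) The functional is increasing in the red pattern along x-merges. -/
def IncrRed (F : P3 → P3 → ℤ) : Prop :=
  ∀ s s' t : P3, Trans3 s ∧ Trans3 s' ∧ Trans3 t ∧ XMerge s s' → F s t ≤ F s' t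

/-- (ii) The key inequality along x-merges in both colours. -/
def KeyIneq (F : P3 → P3 → ℤ) : Prop :=
  ∀ s s' t t' : P3, Trans3 s ∧ Trans3 s' ∧ Trans3 t ∧ Trans3 t' ∧ XMerge s s' ∧ XMerge t t' →
    F s t + F s' t' ≤ F s' t + F s t'

/-- Condition (a) is decidable. -/
instance (F : P3 → P3 → ℤ) : Decidable (Anchored F) := by unfold Anchored; infer_instance

/-- Condition (i) is decidable. -/
instance (F : P3 → P3 → ℤ) : Decidable (IncrRed F) := by unfold IncrRed; infer_instance

/-- Condition (ii) is decidable. -/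
instance (F : P3 → P3 → ℤ) : Decidable (KeyIneq F) := by unfold KeyIneq; infer_instance

/-- The pointwise inequality of the induction step for an anchored functional. -/
theorem F_ind_ineq {F : P3 → P3 → ℤ} (hi : IncrRed F) (hii : KeyIneq F) (a b : Prop) [Decidable a]
    [Decidable b] (hba : b → a) (s s' t t' : P3) (hs : Trans3 s) (hs' : Trans3 s') (ht : Trans3 t)
    (ht' : Trans3 t') (hx : XMerge s s') (hy : XMerge t t') :
    ((if a then F s t else 0) + (if b then F s' t' else 0) : ℤ) ≤
      (if a then F s' t else 0) + (if b then F s t' else 0) := by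
  have k1 := hi s s' t ⟨hs, hs', ht, hx⟩
  have k2 := hii s s' t t' ⟨hs, hs', ht, ht', hx, hy⟩
  by_cases ha : a <;> by_cases hb : b
  · simp only [ha, hb, ↓reduceIte]; exact k2
  · simp only [ha, hb, ↓reduceIte, add_zero]; exact k1
  · exact absurd (hba hb) ha
  · simp only [ha, hb, ↓reduceIte, add_zero, le_refl]

omit [DecidableEq E₁] in
open Classical in
/-- Without a free edge at the anchor's double-component every summand of an anchored functional vanishes. -/
theorem F_sig_eq_zero {F : P3 → P3 → ℤ} (ha : Anchored F) (st : E₁ → EStat)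
    (hA : ∀ e, st e = .free → ¬ (Z₁.fst e ∈ dblCompS Z₁ st a₁ ∨ Z₁.snd e ∈ dblCompS Z₁ st a₁))
    (ω : E₁ → Bool) : F (rsig Z₁ u u' a₁ st ω) (bsig Z₁ u u' a₁ st ω) = 0 := by
  apply ha
  · simp only [rsig, bsig, decide_eq_decide]
    rw [RdS_iff_dblComp Z₁ a₁ st hA, MgS_iff_dblComp Z₁ a₁ st hA]
  · simp only [rsig, bsig, decide_eq_decide]
    rw [RdS_iff_dblComp Z₁ a₁ st hA, MgS_iff_dblComp Z₁ a₁ st hA]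

variable [Fintype E₁]

open Classical in
/-- The induction step for an anchored functional at a free edge touching the anchor's double-component. -/
theorem cntF_step {F : P3 → P3 → ℤ} (hi : IncrRed F) (hii : KeyIneq F) (st : E₁ → EStat) (f : E₁)
    (hf : st f = .free) (hT : Z₁.fst f ∈ dblCompS Z₁ st a₁ ∨ Z₁.snd f ∈ dblCompS Z₁ st a₁)
    {V : (E₁ → Bool) → Prop} (hV : UpSet V) :
    cntF Z₁ u u' a₁ F (Function.update st f .absent) (sliceV V f true)
        + cntF Z₁ u u' a₁ F (Function.update st f .double) (sliceV V f false) ≤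
      (∑ ω : E₁ → Bool, if sliceV V f true ω then
          F (rsig Z₁ u u' a₁ (Function.update st f .double) ω) (bsig Z₁ u u' a₁ (Function.update st f .absent) ω)
        else 0)
        + ∑ ω : E₁ → Bool, if sliceV V f false ω then
            F (rsig Z₁ u u' a₁ (Function.update st f .absent) ω)
              (bsig Z₁ u u' a₁ (Function.update st f .double) ω)
          else 0 := by
  unfold cntF
  rw [← Finset.sum_add_distrib, ← Finset.sum_add_distrib]
  refine Finset.sum_le_sum fun ω _ => ?_
  exact F_ind_ineq hi hii _ _ (sliceV_false_le hV f ω) _ _ _ _ (trans3_rsig Z₁ u u' a₁ _ ω)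
    (trans3_rsig Z₁ u u' a₁ _ ω) (trans3_bsig Z₁ u u' a₁ _ ω) (trans3_bsig Z₁ u u' a₁ _ ω)
    (xmerge_rsig Z₁ u u' a₁ hf hT ω) (xmerge_bsig Z₁ u u' a₁ hf hT ω)

open Classical in
/-- Without a free edge at the anchor's double-component the count of an anchored functional vanishes. -/
theorem cntF_eq_zero {F : P3 → P3 → ℤ} (ha : Anchored F) (st : E₁ → EStat)
    (hA : ∀ e, st e = .free → ¬ (Z₁.fst e ∈ dblCompS Z₁ st a₁ ∨ Z₁.snd e ∈ dblCompS Z₁ st a₁))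
    (V : (E₁ → Bool) → Prop) : cntF Z₁ u u' a₁ F st V = 0 := by
  unfold cntF
  refine Finset.sum_eq_zero fun ω _ => ?_
  rw [F_sig_eq_zero Z₁ u u' a₁ ha st hA ω]
  simp

open Classical in
/-- **THEOREM (THE ANCHORED CONE)**: a functional anchored at `a₁` that is increasing in red along x-merges and
satisfies the key inequality has non-negative count on every up-set of every status. -/
theorem cntF_nonneg_of_anchored {F : P3 → P3 → ℤ} (ha : Anchored F) (hi : IncrRed F) (hii : KeyIneq F)
    (st : E₁ → EStat) {V : (E₁ → Bool) → Prop} (hV : UpSet V) : 0 ≤ cntF Z₁ u u' a₁ F st V := by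
  suffices h : ∀ n : ℕ, ∀ st : E₁ → EStat, nfree st = n → ∀ V : (E₁ → Bool) → Prop, UpSet V →
      0 ≤ cntF Z₁ u u' a₁ F st V from h _ st rfl V hV
  intro n
  induction n with
  | zero =>
    intro st hst V _
    have hno : ∀ e, st e ≠ .free := by
      intro e he
      have : e ∈ (univ.filter fun e => st e = .free) := by simp [he]
      rw [Finset.card_eq_zero.mp hst] at this
      exact absurd this (Finset.notMem_empty e)
    rw [cntF_eq_zero Z₁ u u' a₁ ha st (fun e he _ => hno e he) V]
  | succ n ih =>
    intro st hst V hV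
    by_cases hex : ∃ f, st f = .free ∧ (Z₁.fst f ∈ dblCompS Z₁ st a₁ ∨ Z₁.snd f ∈ dblCompS Z₁ st a₁)
    · obtain ⟨f, hf, hT⟩ := hex
      have hab := ih (Function.update st f .absent) (by
        have := nfree_update hf (s := .absent) (by decide); omega) (sliceV V f true) (upSet_sliceV hV f true)
      have hdb := ih (Function.update st f .double) (by
        have := nfree_update hf (s := .double) (by decide); omega) (sliceV V f false) (upSet_sliceV hV f false)
      have hR := cntF_rec Z₁ u u' a₁ F st f hf V
      have hS := cntF_step Z₁ u u' a₁ hi hii st f hf hT hV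
      linarith
    · have hA : ∀ e, st e = .free → ¬ (Z₁.fst e ∈ dblCompS Z₁ st a₁ ∨ Z₁.snd e ∈ dblCompS Z₁ st a₁) :=
        fun e he h => hex ⟨e, he, h⟩
      rw [cntF_eq_zero Z₁ u u' a₁ ha st hA V]

/-! ## Instances -/

/-- S1 is anchored. -/
theorem S1F_anchored : Anchored S1F := by decide

/-- S1 is increasing in red along x-merges. -/
theorem S1F_incrRed : IncrRed S1F := by decide

/-- S1 satisfies the key inequality. -/
theorem S1F_keyIneq : KeyIneq S1F := by decide

/-- The (x,z)-two-mark domination as a functional: `[x ~_R z] − [x ~_B z]`. -/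
def twoMarkF (s t : P3) : ℤ := (if s.2.1 = true then 1 else 0) - (if t.2.1 = true then 1 else 0)

/-- The two-mark domination is anchored. -/
theorem twoMarkF_anchored : Anchored twoMarkF := by decide

/-- The two-mark domination is increasing in red along x-merges. -/
theorem twoMarkF_incrRed : IncrRed twoMarkF := by decide

/-- The two-mark domination satisfies the key inequality. -/
theorem twoMarkF_keyIneq : KeyIneq twoMarkF := by decide

/-- THE SET DOMINATION of the anchor against the two exits on «the exits are blue-separated»: `+1` on `(s₁,⊥)`,
`(s₂,⊥)`, `(⊤,⊥)` (`x` red-connected to `y` or `z`, blue-isolated), `−1` on `(⊥,s₁)`, `(⊥,s₂)`, `(s₃,s₁)`, `(s₃,s₂)`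
(`x` blue-connected to exactly one of `y, z`, red-connected to neither). -/
def setDomF (s t : P3) : ℤ :=
  (if (s.1 = true ∨ s.2.1 = true) ∧ t = (false, false, false) then 1 else 0)
    - (if (s.1 = false ∧ s.2.1 = false) ∧ (t = (true, false, false) ∨ t = (false, true, false)) then 1 else 0)

/-- The set domination is anchored. -/
theorem setDomF_anchored : Anchored setDomF := by decide

/-- The set domination is increasing in red along x-merges. -/
theorem setDomF_incrRed : IncrRed setDomF := by decide

/-- The set domination satisfies the key inequality. -/
theorem setDomF_keyIneq : KeyIneq setDomF := by decide

open Classical in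
/-- **THE SET DOMINATION** on every up-set of every status:
`#(⊥,s₁) + #(⊥,s₂) + #(s₃,s₁) + #(s₃,s₂) ≤ #(s₁,⊥) + #(s₂,⊥) + #(⊤,⊥)`. -/
theorem cntF_setDom_nonneg (st : E₁ → EStat) {V : (E₁ → Bool) → Prop} (hV : UpSet V) :
    0 ≤ cntF Z₁ u u' a₁ setDomF st V :=
  cntF_nonneg_of_anchored Z₁ u u' a₁ setDomF_anchored setDomF_incrRed setDomF_keyIneq st hV

open Classical in
/-- THEOREM (S1) again, as an instance of the anchored cone. -/
theorem cntS1_nonneg' (st : E₁ → EStat) {V : (E₁ → Bool) → Prop} (hV : UpSet V) :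
    0 ≤ cntS1 Z₁ u u' a₁ st V :=
  cntF_nonneg_of_anchored Z₁ u u' a₁ S1F_anchored S1F_incrRed S1F_keyIneq st hV

end MultiExit

end ZoneZ

end PercRepro
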